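import Summits.QuantumFields.YangMills.Theorems.UnitScaleTiltProp8ChartLocalityFlat
import Summits.QuantumFields.YangMills.Theorems.UnitScaleTiltProp8ChartDoubleBarAccumulated
import HarnessLib

/-!
# Route `UnitScaleTilt`, crux K1 child «MinimiserStabilityRegPr» (stmt-QuantumFields-19200), registered stub `stub_halvingStep` (H), the S11∕S12 junction of the
# end-to-end knit, (Φ-1) FIBRE HALF for the localised competitor map (LEAD ★w5-19200 g4 RULING L-1 (R1); census #45) — **THE TOWER PINNING LEMMA**:
# two fields whose double-bar data agree at EVERY CONSTRAINT INDEX of a nested family have the SAME `k`-fold double-bar average at EVERY top bond, hence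
# single-bar (`eml`) `k`-fold averages that differ by a COARSE GAUGE TRANSFORMATION (the quotient of their accumulated frames)

Cell `ym3-torus` (HUMAN RULING D-0037, YM ladder rung R3 — continuum SU(2) YM₃ on the torus is a RUNG, not the Clay problem), width seat `ym-ust-19200-w1` gen 7.
`--supports stmt-QuantumFields-19200 --as helper`; def-free, 0 sorry, standard axioms; counts toward nothing by itself.

WHY.  The competitors `X ∈ T` of the chart of record share their multi-level LINEAR data `Q X = B` and, by the chart's exactness
(`chartLogFlat (X − Hs(Dsel X)) = Qlin X`, FILE E v3), the DOUBLE-BAR data `U̿^{(j)}(·)(c)` of their charted fields at every constraint index `(j, c) ∈ BondIdx D`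
(`D` the cube sequence (144)); off the chart region every competitor is the minimiser's gauge copy.  The fibre condition of [Balaban1985Variational] (6),
however, is the `k`-fold (0.4) average at EVERY bond of the top lattice — most of which are NOT constraint indices (their blocks sit over the finer annuli
`Λ_j`, `j < k`).  This file supplies the bridge, for ANY nested family and ANY two units-valued fields: (§1) index data pinned ⇒ double-bar data pinned at
every non-deep bond of every level (induction over the levels with the two-block read set of the recomputed-frame average, ✓`ChartLocalityFlat.dbarAvgU_congr₂`:
a level-`(i+1)` bond with both end-blocks outside `Ω_{i+1}` reads only level-`i` bonds that are not deep), in particular at EVERY top bond (`Ω_{k+1} = ∅`); (§2) by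
the accumulated-frame identity `U̿^{(j)} = (Ū^{(j)})^{V_j⁻¹}` (✓`ChartDoubleBarAccumulated.dbarIterU_eq_gaugeActT_emlIterU`, [Balaban1985Averaging] (92)) the
single-bar `k`-fold averages then differ by the coarse gauge `V_k(W)·V_k(W′)⁻¹`; (§3) if moreover `W′ = (W₀)^{g}` for a fine gauge `g`, by the covariance of the
single bar (✓`Prop8ChartCovariance.emlIterU_gaugeActT`) `Ū^{(k)}(W) = (Ū^{(k)} W₀)^{g′}` for an explicit coarse `g′` — the (Φ-1) fibre half up to the SU(2)∕`ℰp`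
dictionary and the lift of `g′⁻¹` (next file of the package).

WHAT IS PROVED (ns `…Theorems.HalvingCompetitorMapTower`; any `P : Params`, any complete normed `ℂ`-algebra `𝔸`, any `D : Domains P`, units-valued fields).
* §1 ★ `dbarIterU_eq_of_index_eq` — `(∀ idx : BondIdx D, U̿ W idx = U̿ W′ idx) → ∀ i ≤ D.k, ∀ c : PBond P i, ¬Deep i c₋ → ¬Deep i c₊ → U̿^{(i)} W c = U̿^{(i)} W′ c`;
  ★ `dbarIterU_top_eq_of_index_eq` — at `i = D.k`, EVERY bond.
* §2 ★ `emlIterU_top_eq_gaugeActT_of_index_eq` — `∃ g : T^{(k)} → 𝔸ˣ` (the frame quotient) with `Ū^{(k)} W = (Ū^{(k)} W′)^{g}`.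
* §3 ★★ `emlIterU_top_eq_gaugeActT_of_index_eq_gaugeActT` — if `W′ = (W₀)^{g₀}` then `∃ g, Ū^{(k)} W = (Ū^{(k)} W₀)^{g}` (the block-centre tower of `g₀` is built
  inside the proof by recursion, no definition).
HONEST SCOPE: algebra of the two towers over landed identities; no estimate, no chart, no SU(2) reading; nothing of print is asserted; NOT a claim about the stub, the crux,
the rung or a mass gap.

References: T. Bałaban, CMP **98** (1985) 17–51 [Balaban1985Averaging] ((11) p.19, (89) p.31, (92) p.31, (97)–(100) p.32, (127) p.36); CMP **96** (1984) 223–250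
[Balaban1984PropagatorsII] ((2.1)–(2.4) p.224); CMP **102** (1985) 277–309 [Balaban1985Variational] ((6) p.278, (144) p.300, (156) p.302); CMP **109** (1987) 249–301
[Balaban1987RG1] ((0.4), (0.11) p.253).
-/

set_option autoImplicit false

noncomputable section

namespace Summit.QuantumFields.YangMills.Theorems.HalvingCompetitorMapTower

open Literature.MathematicalPhysics.QuantumFieldTheory.Balaban1983to89
open T4Continuum BlockAveraging
open B10Eq27TorusAxialLog (gaugeActT gaugeActT_apply)
open B6SectADomainsV1 (Domains)
open B6SectAOperatorsV1 (BondIdx)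
open Summit.QuantumFields.YangMills.Theorems.Prop8Chart (emlIterU emlIterU_gaugeActT)
open Summit.QuantumFields.YangMills.Theorems.Prop8ChartDoubleBar (dbarIterU dbarIterU_zero dbarIterU_succ dbarAvgU_congr₂ exists_accFrames_dbarIterU
  gaugeActT_gaugeActT gaugeActT_const_one)

variable {P : Params} {𝔸 : Type*} [NormedRing 𝔸] [NormedAlgebra ℂ 𝔸] [CompleteSpace 𝔸]

/-! ## §1 Index data pinned ⇒ double-bar data pinned at every non-deep bond, in particular at every top bond -/

section Tower

variable (D : Domains P)

/-- ★ **THE TOWER PINNING LEMMA.**  If two fields have the same double-bar datum at EVERY constraint index of `D` (`(j, c)` with `c ∈ B_j(Λ_j)`), then at every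
level `i ≤ k` their `i`-fold double-bar averages agree at every bond NEITHER end-block of which lies in `Ω_{i+1}` — such a bond is either a constraint index
(one end in `Ω_i`) or reads, through the two-block read set of the recomputed-frame average, only level-`(i−1)` bonds of the same kind.
[cite: Balaban1984PropagatorsII, (2.1)-(2.4) p.224; Balaban1985Averaging, (89) p.31, (127) p.36] -/
theorem dbarIterU_eq_of_index_eq {W W' : GaugeField P 0 𝔸ˣ}
    (hidx : ∀ idx : BondIdx D, dbarIterU (idx.1.1 : ℕ) W idx.1.2 = dbarIterU (idx.1.1 : ℕ) W' idx.1.2) :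
    ∀ (i : ℕ), i ≤ D.k → ∀ c : PBond P i, ¬ D.Deep i c.src → ¬ D.Deep i c.tgt → dbarIterU i W c = dbarIterU i W' c := by
  intro i
  induction i with
  | zero =>
    intro _ c hs ht
    have hlam : D.LamBond 0 c := ⟨Or.inl (by rw [D.Om_zero]; exact Finset.mem_univ _), hs, ht⟩
    exact hidx ⟨⟨⟨0, Nat.succ_pos _⟩, c⟩, hlam⟩
  | succ i ih =>
    intro hi c hs ht
    by_cases hin : c.src ∈ D.Om (i + 1) ∨ c.tgt ∈ D.Om (i + 1)
    · -- a constraint index at level `i+1`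
      have hlam : D.LamBond (i + 1) c := ⟨hin, hs, ht⟩
      exact hidx ⟨⟨⟨i + 1, Nat.lt_succ_of_le hi⟩, c⟩, hlam⟩
    · -- both end-blocks outside `Ω_{i+1}`: the read set consists of non-deep level-`i` bonds
      rw [not_or] at hin
      rw [dbarIterU_succ, dbarIterU_succ]
      refine dbarAvgU_congr₂ (le_trans hi D.hk) c fun e hes het => ih (Nat.le_of_succ_le hi) e ?_ ?_
      · show blockOf e.src ∉ D.Om (i + 1)
        rcases hes with h | h <;> rw [h]
        · exact hin.1
        · exact hin.2
      · show blockOf e.tgt ∉ D.Om (i + 1)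
        rcases het with h | h <;> rw [h]
        · exact hin.1
        · exact hin.2

/-- ★ **AT THE TOP LEVEL EVERY BOND**: `Ω_{k+1} = ∅`, so no top bond is deep — index data pinned ⇒ the `k`-fold double-bar averages agree EVERYWHERE on `T^{(k)}`.
[cite: Balaban1984PropagatorsII, (2.1)-(2.4) p.224; Balaban1985Averaging, (127) p.36] -/
theorem dbarIterU_top_eq_of_index_eq {W W' : GaugeField P 0 𝔸ˣ}
    (hidx : ∀ idx : BondIdx D, dbarIterU (idx.1.1 : ℕ) W idx.1.2 = dbarIterU (idx.1.1 : ℕ) W' idx.1.2) (c : PBond P D.k) :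
    dbarIterU D.k W c = dbarIterU D.k W' c := by
  have hnd : ∀ y : Site P D.k, ¬ D.Deep D.k y := fun y h => by
    have he : D.Om (D.k + 1) = ∅ := D.Om_eq_empty (Nat.lt_succ_self _)
    unfold Domains.Deep at h
    rw [he] at h
    exact absurd h (Finset.notMem_empty _)
  exact dbarIterU_eq_of_index_eq D hidx D.k le_rfl c (hnd _) (hnd _)

end Tower

/-! ## §2 The single-bar `k`-fold averages differ by a coarse gauge (the quotient of the accumulated frames) -/

section Single

variable (D : Domains P)

/-- ★ **PINNED DOUBLE BARS ⇒ SINGLE BARS AGREE UP TO A COARSE GAUGE**: under the hypothesis of `dbarIterU_eq_of_index_eq` there is a gauge map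
`g : T^{(k)} → 𝔸ˣ` — the quotient `V_k(W)·V_k(W′)⁻¹` of the accumulated frames (97) of the two fields — with `Ū^{(k)} W = (Ū^{(k)} W′)^{g}`.
[cite: Balaban1985Averaging, (92) p.31, (97)-(100) p.32, (11) p.19] -/
theorem emlIterU_top_eq_gaugeActT_of_index_eq {W W' : GaugeField P 0 𝔸ˣ}
    (hidx : ∀ idx : BondIdx D, dbarIterU (idx.1.1 : ℕ) W idx.1.2 = dbarIterU (idx.1.1 : ℕ) W' idx.1.2) :
    ∃ g : Site P D.k → 𝔸ˣ, emlIterU D.k W = gaugeActT g (emlIterU D.k W') := by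
  obtain ⟨V, _, _, hV⟩ := exists_accFrames_dbarIterU (P := P) W
  obtain ⟨V', _, _, hV'⟩ := exists_accFrames_dbarIterU (P := P) W'
  have htop : dbarIterU D.k W = dbarIterU D.k W' := funext fun c => dbarIterU_top_eq_of_index_eq D hidx c
  refine ⟨fun y => V D.k y * (V' D.k y)⁻¹, ?_⟩
  -- `Ū W = V•U̿ W = V•U̿ W′ = V•V′⁻¹•Ū W′`
  have h1 : emlIterU D.k W = gaugeActT (fun y => V D.k y) (dbarIterU D.k W) := by
    rw [hV D.k, gaugeActT_gaugeActT]
    have : (fun y : Site P D.k => V D.k y * (V D.k y)⁻¹) = fun _ => 1 := funext fun y => mul_inv_cancel _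
    rw [this, gaugeActT_const_one]
  rw [h1, htop, hV' D.k, gaugeActT_gaugeActT]

end Single

/-! ## §3 When the second field is a fine gauge copy -/

section Copy

variable (D : Domains P)

/-- ★★ **THE FIBRE HALF, ALGEBRAIC CORE**: if the double-bar data of `W` and of a fine gauge copy `(W₀)^{g₀}` agree at every constraint index of `D`, then the
`k`-fold single-bar average of `W` is a COARSE GAUGE COPY of that of `W₀`: `Ū^{(k)} W = (Ū^{(k)} W₀)^{g}` — the frame quotient of §2 composed with the covariance
`Ū^{(k)}(W₀^{g₀}) = (Ū^{(k)} W₀)^{g₀∘emb^k}` (the finest gauge read at the iterated block centres).  In the knit: `W` = the localised competitor, `W₀` = the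
minimiser, `g₀ = u⁻¹`; with the SU(2)∕`ℰp` dictionary and a fine lift of `g⁻¹` this is `(competitor)^{h} ∈ 𝔅_k(V)`.
[cite: Balaban1985Averaging, (11) p.19, (87)-(88) p.31, (92) p.31; Balaban1985Variational, (6) p.278, (156) p.302] -/
theorem emlIterU_top_eq_gaugeActT_of_index_eq_gaugeActT {W W₀ : GaugeField P 0 𝔸ˣ} (g₀ : GaugeTransf P 0 𝔸ˣ)
    (hidx : ∀ idx : BondIdx D, dbarIterU (idx.1.1 : ℕ) W idx.1.2 = dbarIterU (idx.1.1 : ℕ) (gaugeActT g₀ W₀) idx.1.2) :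
    ∃ g : Site P D.k → 𝔸ˣ, emlIterU D.k W = gaugeActT g (emlIterU D.k W₀) := by
  -- the block-centre tower of `g₀`
  let us : (i : ℕ) → GaugeTransf P i 𝔸ˣ := fun i => Nat.rec (motive := fun i => Site P i → 𝔸ˣ) g₀ (fun _ ui y => ui (emb y)) i
  have hus0 : us 0 = g₀ := rfl
  have hus : ∀ (i : ℕ) (y : Site P (i + 1)), us (i + 1) y = us i (emb y) := fun _ _ => rfl
  obtain ⟨g, hg⟩ := emlIterU_top_eq_gaugeActT_of_index_eq D hidx
  have hcov : emlIterU D.k (gaugeActT g₀ W₀) = gaugeActT (us D.k) (emlIterU D.k W₀) := by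
    rw [← hus0]; exact emlIterU_gaugeActT us hus W₀ D.k
  refine ⟨fun y => g y * us D.k y, ?_⟩
  rw [hg, hcov, gaugeActT_gaugeActT]

end Copy

end Summit.QuantumFields.YangMills.Theorems.HalvingCompetitorMapTower

end
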